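import Mathlib
import HarnessLib

/-!
# `Hom` commutes with flat base change for finitely presented modules

Topic: `Literature/RingTheory/CohomologyAnnihilator`.  For a commutative ring `R`, a FLAT commutative `R`-algebra `S`, a
finitely presented `R`-module `M` and any `R`-module `N`, the natural map
`S ⊗_R Hom_R(M, N) → Hom_S(S ⊗_R M, S ⊗_R N)`, `s ⊗ f ↦ s · (1_S ⊗ f)`, is bijective; equivalently
`f ↦ 1_S ⊗ f` (`LinearMap.baseChangeHom`) is a base change along `R → S` (`IsBaseChange`).  Mathlib has the cases
`M` finite free (`IsBaseChange.linearMapLeftRight`) and `S` a localisation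
(`Module.FinitePresentation.linearEquivMapExtendScalars`); the flat case is Bourbaki, *Algèbre commutative* I §2
no. 10 Prop. 11 / Matsumura, *Commutative Ring Theory*, Thm. 7.11: present `F₁ → F₀ → M → 0`, apply the left exact
`Hom(−, N)`, the exact `S ⊗_R −`, and compare with `Hom_S(−, S ⊗ N)` of the base-changed presentation (five lemma on
kernels).  Recorded for the level-exact completion transport of the cohomology annihilator (route
`ResolutionOfSingularities/HomologicalConductor`, rung S-2, toric class: double duals of punctured-free modules).

* `liftBaseChange_baseChangeHom_lTensor_lcomp` — naturality of the comparison map in the source;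
* `bijective_liftBaseChange_baseChangeHom_of_free` — the finite free case (from Mathlib's `linearMapLeftRight`);
* `exact_lcomp_of_exact_of_surjective`, `lcomp_injective_of_surjective` — left exactness of `Hom(−, N)`;
* `isBaseChange_baseChangeHom` — **the theorem**: `IsBaseChange S (LinearMap.baseChangeHom R S M N)` for `S` flat and
  `M` finitely presented; `bijective_liftBaseChange_baseChangeHom` — the bijectivity form.

References: H. Matsumura, *Commutative Ring Theory*, Thm. 7.11 [`Matsumura1987`]; N. Bourbaki, *Commutative Algebra*,
Ch. I §2.10 Prop. 11.
-/

noncomputable section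

open TensorProduct LinearMap Function

universe u

namespace Literature.RingTheory.CohomologyAnnihilator

variable {R : Type u} [CommRing R] (S : Type u) [CommRing S] [Algebra R S]
variable {M M' N : Type u} [AddCommGroup M] [Module R M] [AddCommGroup M'] [Module R M'] [AddCommGroup N] [Module R N]

/-! ## The comparison map and its naturality -/

/-- On pure tensors the comparison map `S ⊗ Hom_R(M,N) → Hom_S(S⊗M, S⊗N)` is `s ⊗ f ↦ s · (1 ⊗ f)` (the map of [Matsumura1987, Thm. 7.11]). [cite: Matsumura1987, Thm. 7.11] -/
theorem liftBaseChange_baseChangeHom_tmul (s : S) (f : M →ₗ[R] N) :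
    (LinearMap.baseChangeHom R S M N).liftBaseChange S (s ⊗ₜ f) = s • f.baseChange S :=
  LinearMap.liftBaseChange_tmul S _ s f

/-- **Naturality in the source**: for `h : M' → M`, comparing after precomposition with `h` is precomposition with
`1 ⊗ h` after comparing (naturality used in the proof of [Matsumura1987, Thm. 7.11]). [cite: Matsumura1987, Thm. 7.11 (proof)] -/
theorem liftBaseChange_baseChangeHom_lTensor_lcomp (h : M' →ₗ[R] M) (x : S ⊗[R] (M →ₗ[R] N)) :
    (LinearMap.baseChangeHom R S M' N).liftBaseChange S ((LinearMap.lcomp R N h).lTensor S x) =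
      ((LinearMap.baseChangeHom R S M N).liftBaseChange S x) ∘ₗ h.baseChange S := by
  induction x using TensorProduct.induction_on with
  | zero => simp
  | tmul s f =>
    rw [LinearMap.lTensor_tmul, LinearMap.lcomp_apply', liftBaseChange_baseChangeHom_tmul,
      liftBaseChange_baseChangeHom_tmul, LinearMap.baseChange_comp, LinearMap.smul_comp]
  | add x y hx hy => rw [map_add, map_add, hx, hy, map_add, LinearMap.add_comp]

/-! ## The finite free case -/

/-- **Finite free source**: the comparison map is bijective for `M` finite free (Mathlib's
`IsBaseChange.linearMapLeftRight`, identified with `s ⊗ f ↦ s · (1 ⊗ f)`); the first step of the proof of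
[Matsumura1987, Thm. 7.11]. [cite: Matsumura1987, Thm. 7.11 (proof, free case)] -/
theorem bijective_liftBaseChange_baseChangeHom_of_free (F : Type u) [AddCommGroup F] [Module R F] [Module.Free R F]
    [Module.Finite R F] :
    Function.Bijective ((LinearMap.baseChangeHom R S F N).liftBaseChange S) := by
  have j : IsBaseChange S (TensorProduct.mk R S F 1) := TensorProduct.isBaseChange R F S
  have β : IsBaseChange S (TensorProduct.mk R S N 1) := TensorProduct.isBaseChange R N S
  have hF := IsBaseChange.linearMapLeftRight j β
  -- `linearMapLeftRightHom j _ f = f.baseChange S`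
  have hid : ∀ f : F →ₗ[R] N, IsBaseChange.linearMapLeftRightHom j (TensorProduct.mk R S N 1) f =
      f.baseChange S := by
    intro f
    apply (LinearMap.liftBaseChangeEquiv S).symm.injective
    apply LinearMap.ext
    intro m
    rw [LinearMap.liftBaseChangeEquiv_symm_apply, LinearMap.liftBaseChangeEquiv_symm_apply,
      LinearMap.baseChange_tmul]
    exact IsBaseChange.linearMapLeftRightHom_comp_apply j (TensorProduct.mk R S N 1) f m
  -- the comparison map is `hF.equiv`
  have heq : ((LinearMap.baseChangeHom R S F N).liftBaseChange S : S ⊗[R] (F →ₗ[R] N) → _) = hF.equiv := by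
    funext x
    induction x using TensorProduct.induction_on with
    | zero => simp
    | tmul s f => rw [liftBaseChange_baseChangeHom_tmul, IsBaseChange.equiv_tmul, hid]
    | add x y hx hy => rw [map_add, map_add, hx, hy]
  rw [heq]
  exact hF.equiv.bijective

/-! ## Left exactness of `Hom(−, N)` -/

section HomLeftExact

variable {A : Type u} [CommRing A] {X Y Z W : Type u} [AddCommGroup X] [Module A X] [AddCommGroup Y] [Module A Y]
  [AddCommGroup Z] [Module A Z] [AddCommGroup W] [Module A W]

/-- Precomposition with a surjection is injective on `Hom` (left exactness of `Hom(−, W)`, first half; used in the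
proof of [Matsumura1987, Thm. 7.11]). [cite: Matsumura1987, Thm. 7.11 (proof, left exactness of Hom)] -/
theorem lcomp_injective_of_surjective {π : Y →ₗ[A] Z} (hπ : Function.Surjective π) :
    Function.Injective (LinearMap.lcomp A W π) := by
  intro f₁ f₂ h
  rw [LinearMap.lcomp_apply', LinearMap.lcomp_apply'] at h
  exact (LinearMap.cancel_right hπ).mp h

/-- `Hom(−, W)` is left exact: for `X →g Y →π Z → 0` exact, `Hom(Z,W) →π* Hom(Y,W) →g* Hom(X,W)` is exact at
`Hom(Y,W)` (used in the proof of [Matsumura1987, Thm. 7.11]). [cite: Matsumura1987, Thm. 7.11 (proof, left exactness of Hom)] -/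
theorem exact_lcomp_of_exact_of_surjective {g : X →ₗ[A] Y} {π : Y →ₗ[A] Z} (hex : Function.Exact g π)
    (hπ : Function.Surjective π) :
    Function.Exact (LinearMap.lcomp A W π) (LinearMap.lcomp A W g) := by
  intro φ
  constructor
  · intro hφ
    -- `φ ∘ g = 0`, so `φ` kills `ker π = range g` and factors through `π`
    rw [LinearMap.lcomp_apply'] at hφ
    have hker : LinearMap.ker π ≤ LinearMap.ker φ := by
      intro y hy
      rw [LinearMap.mem_ker] at hy ⊢
      obtain ⟨x, rfl⟩ := (hex y).mp hy
      exact congrArg (fun ψ => ψ x) hφ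
    refine ⟨(LinearMap.ker π).liftQ φ hker ∘ₗ (π.quotKerEquivOfSurjective hπ).symm.toLinearMap, ?_⟩
    rw [LinearMap.lcomp_apply']
    apply LinearMap.ext
    intro y
    simp only [LinearMap.coe_comp, LinearEquiv.coe_coe, Function.comp_apply]
    have : (π.quotKerEquivOfSurjective hπ).symm (π y) = Submodule.Quotient.mk y := by
      rw [LinearEquiv.symm_apply_eq]
      rfl
    rw [this, Submodule.liftQ_apply]
  · rintro ⟨ψ, rfl⟩
    rw [LinearMap.lcomp_apply', LinearMap.lcomp_apply', LinearMap.comp_assoc, hex.linearMap_comp_eq_zero,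
      LinearMap.comp_zero]

end HomLeftExact

/-! ## The theorem -/

/-- **The comparison map `S ⊗_R Hom_R(M,N) → Hom_S(S ⊗ M, S ⊗ N)` is bijective** for `S` flat over `R` and `M`
finitely presented (diagram chase over a finite presentation `F₁ → F₀ → M → 0`). [cite: Matsumura1987, Thm. 7.11] -/
theorem bijective_liftBaseChange_baseChangeHom [Module.Flat R S] [Module.FinitePresentation R M] :
    Function.Bijective ((LinearMap.baseChangeHom R S M N).liftBaseChange S) := by
  -- a finite presentation `F₁ →g F₀ →π M → 0`
  obtain ⟨a, K, e, hK⟩ := Module.FinitePresentation.exists_fin R M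
  let π : (Fin a → R) →ₗ[R] M := e.symm.toLinearMap ∘ₗ K.mkQ
  have hπ : Function.Surjective π := e.symm.surjective.comp K.mkQ_surjective
  have hkerπ : LinearMap.ker π = K := by
    change LinearMap.ker (e.symm.toLinearMap ∘ₗ K.mkQ) = K
    rw [LinearMap.ker_comp, LinearEquiv.ker, Submodule.comap_bot, Submodule.ker_mkQ]
  haveI : Module.Finite R K := Module.Finite.iff_fg.mpr hK
  obtain ⟨b, g₀, hg₀⟩ := Module.Finite.exists_fin' R K
  let g : (Fin b → R) →ₗ[R] (Fin a → R) := K.subtype ∘ₗ g₀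
  have hex : Function.Exact g π := by
    intro y
    rw [← LinearMap.mem_ker, hkerπ]
    constructor
    · intro hy
      obtain ⟨x, hx⟩ := hg₀ ⟨y, hy⟩
      exact ⟨x, by change (K.subtype (g₀ x)) = y; rw [hx]; rfl⟩
    · rintro ⟨x, rfl⟩
      exact (g₀ x).2
  -- notation for the comparison maps
  let θ : ∀ (X : Type u) [AddCommGroup X] [Module R X],
      S ⊗[R] (X →ₗ[R] N) →ₗ[S] (S ⊗[R] X →ₗ[S] S ⊗[R] N) :=
    fun X _ _ => (LinearMap.baseChangeHom R S X N).liftBaseChange S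
  have hθ₀ : Function.Bijective (θ (Fin a → R)) := bijective_liftBaseChange_baseChangeHom_of_free S (Fin a → R)
  have hθ₁ : Function.Bijective (θ (Fin b → R)) := bijective_liftBaseChange_baseChangeHom_of_free S (Fin b → R)
  -- the top row `0 → S⊗Hom(M,N) → S⊗Hom(F₀,N) → S⊗Hom(F₁,N)` (flatness)
  have hinj : Function.Injective ((LinearMap.lcomp R N π).lTensor S) :=
    Module.Flat.lTensor_preserves_injective_linearMap _ (lcomp_injective_of_surjective hπ)
  have hexT : Function.Exact ((LinearMap.lcomp R N π).lTensor S) ((LinearMap.lcomp R N g).lTensor S) :=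
    Module.Flat.lTensor_exact S (exact_lcomp_of_exact_of_surjective hex hπ)
  -- the base-changed presentation
  have hπS : Function.Surjective (π.baseChange S) := by
    rw [LinearMap.baseChange_eq_ltensor]; exact LinearMap.lTensor_surjective S hπ
  have hexS : Function.Exact (g.baseChange S) (π.baseChange S) := by
    rw [LinearMap.baseChange_eq_ltensor, LinearMap.baseChange_eq_ltensor]
    exact lTensor_exact S hex hπ
  constructor
  · -- injectivity
    intro x₁ x₂ h
    apply hinj
    apply hθ₀.1
    rw [liftBaseChange_baseChangeHom_lTensor_lcomp, liftBaseChange_baseChangeHom_lTensor_lcomp]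
    exact congrArg (fun ψ => ψ ∘ₗ π.baseChange S) h
  · -- surjectivity
    intro ψ
    obtain ⟨y, hy⟩ := hθ₀.2 (ψ ∘ₗ π.baseChange S)
    -- `(g* ⊗ S) y = 0` since `θ_{F₁}` of it is `ψ ∘ π_S ∘ g_S = 0`
    have hy0 : (LinearMap.lcomp R N g).lTensor S y = 0 := by
      apply hθ₁.1
      change θ (Fin b → R) ((LinearMap.lcomp R N g).lTensor S y) = θ (Fin b → R) 0
      rw [liftBaseChange_baseChangeHom_lTensor_lcomp, map_zero]
      change θ (Fin a → R) y ∘ₗ g.baseChange S = 0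
      rw [hy, LinearMap.comp_assoc, hexS.linearMap_comp_eq_zero, LinearMap.comp_zero]
    obtain ⟨x, hx⟩ := (hexT y).mp hy0
    refine ⟨x, ?_⟩
    apply (LinearMap.cancel_right hπS).mp
    change θ M x ∘ₗ π.baseChange S = ψ ∘ₗ π.baseChange S
    rw [← liftBaseChange_baseChangeHom_lTensor_lcomp, hx]
    exact hy

/-- **`Hom` commutes with flat base change for finitely presented source**: `f ↦ 1_S ⊗ f`,
`Hom_R(M, N) → Hom_S(S ⊗_R M, S ⊗_R N)`, is a base change along `R → S` (`S ⊗_R Hom_R(M,N) ≅ Hom_S(S⊗M, S⊗N)`) when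
`S` is flat over `R` and `M` is finitely presented. [cite: Matsumura1987, Thm. 7.11] -/
theorem isBaseChange_baseChangeHom [Module.Flat R S] [Module.FinitePresentation R M] :
    IsBaseChange S (LinearMap.baseChangeHom R S M N) :=
  IsBaseChange.of_equiv (LinearEquiv.ofBijective _ (bijective_liftBaseChange_baseChangeHom S (M := M) (N := N)))
    fun f => by
      rw [LinearEquiv.ofBijective_apply, liftBaseChange_baseChangeHom_tmul, one_smul, LinearMap.baseChangeHom_apply]

end Literature.RingTheory.CohomologyAnnihilator

end
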